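import Summits.AtomisticToContinuum.Crystallization.Theorems.FrustratedLawDichotomyAtlasReachTextured
import Literature.MathematicalPhysics.StatisticalMechanics.BarlowStacking

/-!
# FrustratedLawDichotomy · crux `AperiodicFrustratedLawGap` (stmt-AtomisticToContinuum-27623) — K2″ GEOGRAPHY: the NEAR / FAR split of the
# local frustration inequality by affine distance to a close packing (decomp-a2c, prover hand 1, generation 60; critic r1956 GO (480))

(478) `…AtlasReachTextured.aperiodicFrustratedLawGap_of_texturedLocalGap` closes the crux from the LOCAL FRUSTRATION INEQUALITY
  (LFI)(r, g)   every rooted `7/10`-hard-core, Nash, TEXTURED configuration `μ` has `e⋆ + g ≤ symAvgEnergy r μ`.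
The desk geography of (LFI) (hand-1 g60 `num/kappa_aff.py`, `num/profile_aff.py`; critic r1952 (C), r1956): the margin-minimising all-`1/20`-bad Nash
environments are the close packings AFFINELY STRAINED to the badness threshold — a compact `≤ 5`-parameter family (trace-free strains modulo rotation,
scale re-optimised) with margin `κ_aff ≈ 3.5·10⁻³ (hcp) … 4.5·10⁻³ (fcc)` at `r = 11/10`, the cost rising convexly (`≈ 2.1 a²`) along every strain ray —
while every environment that is NOT an affine image of a close packing (icosahedral, Z14–Z16, 13- or 14-coordinated, vacancy-adjacent) reads `≥ 0.02–0.03`.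
This file types that split, and nothing numeric:

* `NearAffine ε₁ ρ μ` — ONE invertible linear map `A` for the whole ball: the atoms of `μ` in the closed `ρ`-ball about the root are TWO-WAY `ε₁`-matched
  (absolute residual `ε₁`; the scale is carried by `A`) with the `A`-image of a BARLOW STACKING (`Literature…BarlowStacking.barlowStacking 1 1 s`, any Hägg
  sequence `s` — fcc, hcp and every close-packed polytype, all of whose sites are fcc- or hcp-like) re-centred at one of its sites `ℓ₀`.  Intended use:
  `ρ = r + 13/10` (the ball that carries the shells of every atom averaged by `symAvgEnergy r`), `ε₁` small against the hard core (then the matching is a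
  bijection near the root; not needed and not proved here).  Monotone in `ε₁` (`NearAffine.mono`), antitone in `ρ` (`NearAffine.anti`).
* ★ `aperiodicFrustratedLawGap_of_texturedLocalGap_nearFar` — THE DOOR: (LFI-near) «gap `gN` at textured Nash hard-core roots whose `ρ`-ball IS near-affine»
  and (LFI-far) «gap `gF` at those whose `ρ`-ball is NOT» ⟹ `AperiodicFrustratedLawGap` (case split over (478), gap `min gN gF`); the version with certified
  rows `aperiodicFrustratedLawGap_of_texturedSymGap_nearFar` splits only the off-row gap.
READING (crit-1 r1956, K2″ geography of record).  NEAR carries the thin margin but is finite-dimensional: (N1) elastic floor of the strained close packings on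
the compact «all sites bad ∧ cheap» strain set [INSTRUMENTABLE, kit], (N2) badness-threshold geometry [INSTRUMENTABLE], (N3) one analytic rigidity lemma
«Nash force balance on a near-affine ball ⇒ the symmetric average does not undercut the affine value» [ATTACKABLE M–L; fcc-near only as sketched — hcp sites
are not centrosymmetric (lens-2 g105 NOTE); cubic remainder `|V‴/V″| = 21` limits `ε₁` to a few `10⁻²`; Lennard-Jones tails want `ρ ≳ 5` or a charge to FAR].
FAR keeps margin `≈ 0.02` and no finite parametrisation (the two-centre-unit problem; IDEA-NEEDED).  An alternative consumer is hand-2's #137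
`…AtlasReachErgodicRegimes.aperiodicFrustratedLawGap_of_invariantSplit` with the re-rooting-invariant class «near-affine at EVERY atom» (measurability owed).
ONE `def` (`NearAffine`) ⇒ definition kind; imports TREE (478) + `Literature…BarlowStacking`; no instance / notation / option; 0 sorry.  Tags: [new: junction].
-/

noncomputable section

namespace Summit.AtomisticToContinuum.Crystallization.Theorems.FrustratedLawDichotomyAtlasReachTexturedNearFar

open MeasureTheory Metric Set
open Literature.MathematicalPhysics.StatisticalMechanics Literature.Probability.Process
open Summit.AtomisticToContinuum.Crystallization.Theorems.ChargedEnergyGapNegative (E3 eStar)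
open Summit.AtomisticToContinuum.Crystallization.Theorems.RepetitiveNetworkReductionRecurrentMember (ApprM NashM)
open Summit.AtomisticToContinuum.Crystallization.Theorems.FrustratedLawDichotomySymSharing (symAvgEnergy)
open Summit.AtomisticToContinuum.Crystallization.Theorems.FrustratedLawDichotomyAtlasReachTextured
  (aperiodicFrustratedLawGap_of_texturedLocalGap aperiodicFrustratedLawGap_of_texturedSymGap)

/-! ## §1. Near-affine balls -/

/-- **NEAR-AFFINE ROOT BALL.**  `NearAffine ε₁ ρ μ`: there are ONE invertible linear map `A : ℝ³ ≃ₗ ℝ³`, a Hägg sequence `s` (coding a Barlow stacking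
`Λ = barlowStacking 1 1 s` — fcc for the constant sequence, hcp for the alternating one, every close-packed polytype in general) and a site `ℓ₀ ∈ Λ` such that,
on the closed `ρ`-ball about the root `0`, the atoms of `μ` and the points `A (ℓ − ℓ₀)`, `ℓ ∈ Λ`, are TWO-WAY matched within the absolute residual `ε₁`:
every atom `x` with `dist x 0 ≤ ρ` has an image point within `ε₁`, and every image point in the ball has an atom within `ε₁`.  One map for the whole ball
(not one per shell); the scale and the strain are carried by `A`, so `ε₁` measures the NON-AFFINE part of the ball only. [new: definition] -/
def NearAffine (ε₁ ρ : ℝ) (μ : Measure E3) : Prop :=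
  ∃ (A : E3 ≃ₗ[ℝ] E3) (s : ℤ → ℤ) (ℓ₀ : E3), IsHaggSeq s ∧ ℓ₀ ∈ barlowStacking 1 1 s ∧
    (∀ x : E3, μ {x} ≠ 0 → dist x 0 ≤ ρ → ∃ ℓ ∈ barlowStacking 1 1 s, dist x (A (ℓ - ℓ₀)) ≤ ε₁) ∧
    (∀ ℓ ∈ barlowStacking 1 1 s, dist (A (ℓ - ℓ₀)) 0 ≤ ρ → ∃ x : E3, μ {x} ≠ 0 ∧ dist x (A (ℓ - ℓ₀)) ≤ ε₁)

/-- `NearAffine` is monotone in the residual `ε₁`. [new: bookkeeping] -/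
theorem NearAffine.mono {ε₁ ε₁' ρ : ℝ} {μ : Measure E3} (h : NearAffine ε₁ ρ μ) (hε : ε₁ ≤ ε₁') : NearAffine ε₁' ρ μ := by
  obtain ⟨A, s, ℓ₀, hs, hℓ₀, h1, h2⟩ := h
  refine ⟨A, s, ℓ₀, hs, hℓ₀, fun x hx hxρ => ?_, fun ℓ hℓ hℓρ => ?_⟩
  · obtain ⟨ℓ, hℓ, hd⟩ := h1 x hx hxρ
    exact ⟨ℓ, hℓ, hd.trans hε⟩
  · obtain ⟨x, hx, hd⟩ := h2 ℓ hℓ hℓρ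
    exact ⟨x, hx, hd.trans hε⟩

/-- `NearAffine` is antitone in the ball radius `ρ` (a smaller ball is matched by the same map). [new: bookkeeping] -/
theorem NearAffine.anti {ε₁ ρ ρ' : ℝ} {μ : Measure E3} (h : NearAffine ε₁ ρ' μ) (hρ : ρ ≤ ρ') : NearAffine ε₁ ρ μ := by
  obtain ⟨A, s, ℓ₀, hs, hℓ₀, h1, h2⟩ := h
  exact ⟨A, s, ℓ₀, hs, hℓ₀, fun x hx hxρ => h1 x hx (hxρ.trans hρ), fun ℓ hℓ hℓρ => h2 ℓ hℓ (hℓρ.trans hρ)⟩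

/-- the re-centred affine image of a Barlow stacking, as a counting measure, is near-affine with residual `0` on every ball (NEAR is inhabited by the close
packings and all their affine images). [new: bookkeeping] -/
theorem nearAffine_image (A : E3 ≃ₗ[ℝ] E3) {s : ℤ → ℤ} (hs : IsHaggSeq s) {ℓ₀ : E3} (hℓ₀ : ℓ₀ ∈ barlowStacking 1 1 s) {ε₁ : ℝ} (hε : 0 ≤ ε₁) (ρ : ℝ) :
    NearAffine ε₁ ρ ((Measure.count : Measure E3).restrict ((fun ℓ : E3 => A (ℓ - ℓ₀)) '' barlowStacking 1 1 s)) := by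
  refine ⟨A, s, ℓ₀, hs, hℓ₀, fun x hx _ => ?_, fun ℓ hℓ _ => ?_⟩
  · have hxS : x ∈ (fun ℓ : E3 => A (ℓ - ℓ₀)) '' barlowStacking 1 1 s := (count_restrict_singleton_ne_zero_iff _ x).1 hx
    obtain ⟨ℓ, hℓ, rfl⟩ := hxS
    exact ⟨ℓ, hℓ, by rw [dist_self]; exact hε⟩
  · refine ⟨A (ℓ - ℓ₀), (count_restrict_singleton_ne_zero_iff _ _).2 ⟨ℓ, hℓ, rfl⟩, by rw [dist_self]; exact hε⟩

/-! ## §2. The NEAR / FAR doors -/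

/-- ★★ **THE NEAR / FAR DOOR (row-free).**  For a symmetric-average radius `r > 0`, a ball radius `ρ`, a residual `ε₁` and two gaps `gN, gF > 0`:
(LFI-near) every rooted `7/10`-hard-core, Nash, textured `μ` whose root `ρ`-ball is `ε₁`-near-affine has `e⋆ + gN ≤ symAvgEnergy r μ`, and
(LFI-far) every such `μ` whose root `ρ`-ball is NOT `ε₁`-near-affine has `e⋆ + gF ≤ symAvgEnergy r μ`
⟹ `AperiodicFrustratedLawGap` ((478) `aperiodicFrustratedLawGap_of_texturedLocalGap` at the gap `min gN gF`, by excluded middle on `NearAffine ε₁ ρ μ`).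
NEAR = the thin-margin, finite-dimensional leaf; FAR = the wide-margin, idea-needed leaf. [new: junction] -/
theorem aperiodicFrustratedLawGap_of_texturedLocalGap_nearFar {r : ℝ} (hr : 0 < r) (ε₁ ρ : ℝ) {gN gF : ℝ} (hgN : 0 < gN) (hgF : 0 < gF)
    (hnear : ∀ μ : Measure E3, IsRootedHardCore (7 / 10) μ → NashM μ → (∃ R₇ R₈ R₉ : ℝ, ApprM μ R₇ R₈ R₉) → NearAffine ε₁ ρ μ →
      eStar + gN ≤ symAvgEnergy r μ)
    (hfar : ∀ μ : Measure E3, IsRootedHardCore (7 / 10) μ → NashM μ → (∃ R₇ R₈ R₉ : ℝ, ApprM μ R₇ R₈ R₉) → ¬ NearAffine ε₁ ρ μ →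
      eStar + gF ≤ symAvgEnergy r μ) :
    Summit.AtomisticToContinuum.Crystallization.Theses.FrustratedLawDichotomy.AperiodicFrustratedLawGap := by
  refine aperiodicFrustratedLawGap_of_texturedLocalGap hr (lt_min hgN hgF) fun μ hμ hN hT => ?_
  by_cases h : NearAffine ε₁ ρ μ
  · exact (add_le_add_right (min_le_left gN gF) eStar).trans (hnear μ hμ hN hT h)
  · exact (add_le_add_right (min_le_right gN gF) eStar).trans (hfar μ hμ hN hT h)

/-- ★ **THE NEAR / FAR DOOR WITH CERTIFIED ROWS.**  Textured symmetric-currency floors on the rows `K i` (`i < n`, margins `≥ m > 0`) and, OFF the rows, the gap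
split by `NearAffine ε₁ ρ` into a near part (`gN > 0`) and a far part (`gF > 0`) ⟹ `AperiodicFrustratedLawGap` ((478) `aperiodicFrustratedLawGap_of_texturedSymGap`
at the off-row gap `min gN gF`). [new: junction] -/
theorem aperiodicFrustratedLawGap_of_texturedSymGap_nearFar {r : ℝ} (hr : 0 < r) (n : ℕ) (K : ℕ → Set (MeasureTheory.Measure (EuclideanSpace ℝ (Fin 3))))
    (hK : ∀ i, MeasurableSet (K i)) (mK : ℕ → ℝ)
    (hfloorT : ∀ i < n, ∀ μ : Measure E3, IsRootedHardCore (7 / 10) μ → NashM μ → (∃ R₇ R₈ R₉ : ℝ, ApprM μ R₇ R₈ R₉) →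
      μ ∈ K i → eStar + mK i ≤ symAvgEnergy r μ)
    {m : ℝ} (hm0 : 0 < m) (hm : ∀ i < n, m ≤ mK i) (ε₁ ρ : ℝ) {gN gF : ℝ} (hgN : 0 < gN) (hgF : 0 < gF)
    (hnear : ∀ μ : Measure E3, IsRootedHardCore (7 / 10) μ → NashM μ → (∃ R₇ R₈ R₉ : ℝ, ApprM μ R₇ R₈ R₉) →
      μ ∉ (⋃ i ∈ Finset.range n, K i) → NearAffine ε₁ ρ μ → eStar + gN ≤ symAvgEnergy r μ)
    (hfar : ∀ μ : Measure E3, IsRootedHardCore (7 / 10) μ → NashM μ → (∃ R₇ R₈ R₉ : ℝ, ApprM μ R₇ R₈ R₉) →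
      μ ∉ (⋃ i ∈ Finset.range n, K i) → ¬ NearAffine ε₁ ρ μ → eStar + gF ≤ symAvgEnergy r μ) :
    Summit.AtomisticToContinuum.Crystallization.Theses.FrustratedLawDichotomy.AperiodicFrustratedLawGap := by
  refine aperiodicFrustratedLawGap_of_texturedSymGap hr n K hK mK hfloorT hm0 hm (lt_min hgN hgF) fun μ hμ hN hT hμU => ?_
  by_cases h : NearAffine ε₁ ρ μ
  · exact (add_le_add_right (min_le_left gN gF) eStar).trans (hnear μ hμ hN hT hμU h)
  · exact (add_le_add_right (min_le_right gN gF) eStar).trans (hfar μ hμ hN hT hμU h)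

end Summit.AtomisticToContinuum.Crystallization.Theorems.FrustratedLawDichotomyAtlasReachTexturedNearFar

end
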